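import Summits.NavierStokesRegularity.NavierStokesRegularity.Theorems.LerayQuarterDissipationFiniteDissipationLiouvilleBlowdownLeaf
import Literature.Analysis.FluidPDE.NewtonPotentialHolder
import HarnessLib

/-!
# `FiniteDissipationLiouville`, line `birth`: the mass form of the blow-down leaf — a Type-I DSS
# singularity carries slice mass `≳ ρ²` on large balls, on every slice

Crux `Summit.NavierStokesRegularity.NavierStokesRegularity.Theses.LerayQuarterDissipation.FiniteDissipationLiouville`
(item stmt-NavierStokesRegularity-22144), route LerayQuarterDissipation, line `birth`, lead prover
ns-lqd-lead g2. NS regularity is NOT proved by anything here; no summit is.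

The weak vanishing of the Navier–Stokes blow-downs `λ g(λ·)` of a slice `g = w(t₀)` — the
hypothesis of the blow-down leaf `eq_zero_of_pastDss_of_blowdown_tendsto_zero` (Albritton–Barker
2019 Thm 4.1) — follows from the purely metric condition that the `L¹` mass of the slice on balls
is `o(ρ²)`: `∫_{B_ρ} |g| ≤ ε ρ²` for `ρ ≥ P(ε)`. (A space-time Type-I envelope gives exactly
`O(ρ²)`: `∫_{B_ρ} C₀/|y| dy = 2π C₀ ρ²`; so for DSS members the question is only the constant in
front of `ρ²`.)

* `tendsto_integral_inner_blowdown_of_mass_littleO` — `o(ρ²)` mass ⇒ trivial blow-downs (change of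
  variables `∫_{B_{R₀}} |g(λx)| dx = λ⁻³ ∫_{B_{λR₀}} |g|`).
* `eq_zero_of_pastDss_of_sliceMass_littleO` — **mass leaf of the DSS wall, every `λ > 1`**: a
  past-DSS member of the finite-dissipation Type-I stratum with ONE slice of `o(ρ²)` mass vanishes.
* `sliceMass_notLittleO_of_pastDss_singular` — contrapositive: a singular past-DSS member has, on
  EVERY slice, `∫_{B_ρ} |w(t₀)| > ε ρ²` for some `ε > 0` along radii `ρ → ∞`.
-/

noncomputable section

open MeasureTheory Set Function Filter Metric
open scoped Topology ENNReal NNReal RealInnerProductSpace Pointwise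

namespace Summit.NavierStokesRegularity.NavierStokesRegularity.Theorems.FiniteDissipationLiouville.Birth

open Literature.Analysis.FluidPDE

-- the problem-side namespace duplicates `NavierStokesRegularity` by design (summit = problem)
set_option linter.dupNamespace false

/-- **`o(ρ²)` slice mass makes the blow-downs trivial.** Let `g : ℝ³ → ℝ³` be continuous with
`∫_{B_ρ} ‖g‖ ≤ ε ρ²` for all `ρ ≥ P(ε)`, every `ε > 0`. Then `∫ ⟪λ g(λx), φ(x)⟫ dx → 0` as
`λ → +∞` for every smooth compactly supported `φ`: if `supp φ ⊆ B_{R₀}` and `|φ| ≤ B`, then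
`|∫ ⟪λ g(λx), φ⟫| ≤ B λ ∫_{B_{R₀}} |g(λx)| dx = B λ⁻² ∫_{B_{λR₀}} |g| ≤ B ε R₀²`. -/
theorem tendsto_integral_inner_blowdown_of_mass_littleO
    {g : EuclideanSpace ℝ (Fin 3) → EuclideanSpace ℝ (Fin 3)} (hg : Continuous g)
    (hmass : ∀ ε > 0, ∃ P : ℝ, ∀ ρ : ℝ, P ≤ ρ → ∫ y in ball 0 ρ, ‖g y‖ ≤ ε * ρ ^ 2)
    {φ : EuclideanSpace ℝ (Fin 3) → EuclideanSpace ℝ (Fin 3)}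
    (hφ : Literature.Analysis.FunctionSpaces.IsTestFunctionOn
      (⊤ : TopologicalSpace.Opens (EuclideanSpace ℝ (Fin 3))) φ) :
    Tendsto (fun lam : ℝ => ∫ x, ⟪lam • g (lam • x), φ x⟫) atTop (𝓝 0) := by
  have hφc : Continuous φ := hφ.contDiff.continuous
  -- a ball containing the support of `φ`, and a bound for `φ`
  obtain ⟨R₁, hR₁⟩ := hφ.hasCompactSupport.isCompact.isBounded.subset_ball (0 : EuclideanSpace ℝ (Fin 3))
  set R₀ : ℝ := max R₁ 1 with hR₀
  have hR₀pos : 0 < R₀ := lt_of_lt_of_le one_pos (le_max_right _ _)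
  have hsupp : tsupport φ ⊆ ball (0 : EuclideanSpace ℝ (Fin 3)) R₀ :=
    hR₁.trans (ball_subset_ball (le_max_left _ _))
  have hφ0 : ∀ x, x ∉ ball (0 : EuclideanSpace ℝ (Fin 3)) R₀ → φ x = 0 := fun x hx =>
    image_eq_zero_of_notMem_tsupport fun h => hx (hsupp h)
  obtain ⟨B, hB⟩ := hφ.hasCompactSupport.exists_bound_of_continuous hφc
  have hB0 : 0 ≤ B := (norm_nonneg _).trans (hB 0)
  refine Metric.tendsto_atTop.2 fun ε hε => ?_
  -- mass threshold for `ε' = ε / (2 (B+1) R₀²)`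
  set ε' : ℝ := ε / (2 * (B + 1) * R₀ ^ 2) with hε'
  have hε'0 : 0 < ε' := by positivity
  obtain ⟨P, hP⟩ := hmass ε' hε'0
  refine ⟨max (P / R₀) 1, fun lam hlam => ?_⟩
  have hlam1 : 1 ≤ lam := le_trans (le_max_right _ _) hlam
  have hlam0 : 0 < lam := lt_of_lt_of_le one_pos hlam1
  have hlamP : P ≤ lam * R₀ := by
    have := le_trans (le_max_left _ _) hlam
    rwa [div_le_iff₀ hR₀pos] at this
  rw [dist_zero_right]
  -- the integrand vanishes off the ball `B_{R₀}`
  set F : EuclideanSpace ℝ (Fin 3) → ℝ := fun x => ⟪lam • g (lam • x), φ x⟫ with hF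
  have hFc : Continuous F := ((hg.comp (continuous_const_smul lam)).const_smul lam).inner hφc
  have hF0 : ∀ x, x ∉ ball (0 : EuclideanSpace ℝ (Fin 3)) R₀ → F x = 0 := fun x hx => by
    simp only [hF, hφ0 x hx, inner_zero_right]
  have e1 : ∫ x, F x = ∫ x in ball 0 R₀, F x :=
    (setIntegral_eq_integral_of_forall_compl_eq_zero hF0).symm
  -- pointwise bound on the ball
  have hGc : Continuous fun x => lam * B * ‖g (lam • x)‖ :=
    continuous_const.mul (hg.comp (continuous_const_smul lam)).norm
  have hGi : IntegrableOn (fun x => lam * B * ‖g (lam • x)‖) (ball 0 R₀) volume :=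
    (hGc.continuousOn.integrableOn_compact (isCompact_closedBall 0 R₀)).mono_set
      ball_subset_closedBall
  have hFi : IntegrableOn F (ball 0 R₀) volume :=
    (hFc.continuousOn.integrableOn_compact (isCompact_closedBall 0 R₀)).mono_set
      ball_subset_closedBall
  have h2 : ‖∫ x in ball 0 R₀, F x‖ ≤ ∫ x in ball 0 R₀, lam * B * ‖g (lam • x)‖ := by
    refine (norm_integral_le_integral_norm _).trans (setIntegral_mono_on hFi.norm hGi
      measurableSet_ball fun x _ => ?_)
    calc ‖F x‖ ≤ ‖lam • g (lam • x)‖ * ‖φ x‖ := norm_inner_le_norm _ _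
      _ ≤ (lam * ‖g (lam • x)‖) * B := by
          rw [norm_smul, Real.norm_of_nonneg hlam0.le]
          exact mul_le_mul_of_nonneg_left (hB x) (by positivity)
      _ = lam * B * ‖g (lam • x)‖ := by ring
  -- change of variables and the mass bound
  have h3 : ∫ x in ball 0 R₀, lam * B * ‖g (lam • x)‖ =
      lam * B * ((lam ^ 3)⁻¹ * ∫ y in ball 0 (lam * R₀), ‖g y‖) := by
    rw [integral_const_mul]
    congr 1
    have h := Measure.setIntegral_comp_smul_of_pos volume (fun y => ‖g y‖) (ball 0 R₀) hlam0
    rw [finrank_euclideanSpace_fin, smul_ball hlam0.ne' (0 : EuclideanSpace ℝ (Fin 3)) R₀,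
      smul_zero, Real.norm_of_nonneg hlam0.le, smul_eq_mul] at h
    exact h
  have h4 : ∫ y in ball 0 (lam * R₀), ‖g y‖ ≤ ε' * (lam * R₀) ^ 2 := hP _ hlamP
  have hmass0 : 0 ≤ ∫ y in ball 0 (lam * R₀), ‖g y‖ := integral_nonneg fun _ => norm_nonneg _
  calc ‖∫ x, F x‖ = ‖∫ x in ball 0 R₀, F x‖ := by rw [e1]
    _ ≤ lam * B * ((lam ^ 3)⁻¹ * ∫ y in ball 0 (lam * R₀), ‖g y‖) := h2.trans h3.le
    _ ≤ lam * B * ((lam ^ 3)⁻¹ * (ε' * (lam * R₀) ^ 2)) := by gcongr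
    _ = B * ε' * R₀ ^ 2 := by field_simp
    _ < ε := by
        rw [hε']
        have hB1 : 0 < B + 1 := by linarith
        have hR2 : 0 < R₀ ^ 2 := by positivity
        calc B * (ε / (2 * (B + 1) * R₀ ^ 2)) * R₀ ^ 2 = ε * (B / (B + 1)) / 2 := by
              field_simp
          _ < ε := by
              have hq : B / (B + 1) < 1 := (div_lt_one hB1).2 (by linarith)
              have hq0 : 0 ≤ B / (B + 1) := div_nonneg hB0 hB1.le
              nlinarith

/-- **The mass leaf of the Type-I DSS wall on the stratum, every `λ > 1`.** A member of the
finite-dissipation Type-I ancient mild stratum which is `c`-DSS on the past (`1 < c`) and has ONE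
slice `w t₀` (`t₀ < 0`) whose `L¹` mass on balls is `o(ρ²)` — for every `ε > 0`,
`∫_{B_ρ} ‖w(t₀)‖ ≤ ε ρ²` for all large `ρ` — vanishes identically on `t < 0`
(`tendsto_integral_inner_blowdown_of_mass_littleO` + the blow-down leaf, Albritton–Barker 2019
Thm 4.1). No envelope is needed for this implication; the envelope of DSS members shows the mass is
always `O(ρ²)`. -/
theorem eq_zero_of_pastDss_of_sliceMass_littleO {C K c : ℝ}
    {w : ℝ → EuclideanSpace ℝ (Fin 3) → EuclideanSpace ℝ (Fin 3)} (hw : IsTypeIAncientMild C w)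
    (hD : ∀ s : ℝ, s < 0 → ∫⁻ x, ‖fderiv ℝ (w s) x‖ₑ ^ 2 ≤ ENNReal.ofReal (K / Real.sqrt (-s)))
    (hc : 1 < c) (hpast : ∀ t : ℝ, t < 0 → ∀ x, c • w (c ^ 2 * t) (c • x) = w t x)
    {t₀ : ℝ} (ht₀ : t₀ < 0)
    (hmass : ∀ ε > 0, ∃ P : ℝ, ∀ ρ : ℝ, P ≤ ρ → ∫ y in ball 0 ρ, ‖w t₀ y‖ ≤ ε * ρ ^ 2) :
    ∀ t < 0, ∀ x, w t x = 0 :=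
  eq_zero_of_pastDss_of_blowdown_tendsto_zero hw hD hc hpast ht₀ fun _ hφ =>
    tendsto_integral_inner_blowdown_of_mass_littleO (hw.continuous_slice ht₀) hmass hφ

/-- **A Type-I DSS singularity carries slice mass `≳ ρ²` on every slice.** If a past-DSS member
of the finite-dissipation stratum is singular at the apex, then on every slice `t₀ < 0` there is
`ε > 0` with `∫_{B_ρ} ‖w(t₀)‖ > ε ρ²` for radii `ρ` beyond every bound. -/
theorem sliceMass_notLittleO_of_pastDss_singular {C K c : ℝ}
    {w : ℝ → EuclideanSpace ℝ (Fin 3) → EuclideanSpace ℝ (Fin 3)} (hw : IsTypeIAncientMild C w)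
    (hD : ∀ s : ℝ, s < 0 → ∫⁻ x, ‖fderiv ℝ (w s) x‖ₑ ^ 2 ≤ ENNReal.ofReal (K / Real.sqrt (-s)))
    (hc : 1 < c) (hpast : ∀ t : ℝ, t < 0 → ∀ x, c • w (c ^ 2 * t) (c • x) = w t x)
    (hsing : ∀ r > 0, ∀ M : ℝ, ∃ t ∈ Set.Ioo (-(r ^ 2)) (0 : ℝ),
      ∃ x ∈ Metric.ball (0 : EuclideanSpace ℝ (Fin 3)) r, M < ‖w t x‖) :
    ∀ t₀ < 0, ∃ ε > 0, ∀ P : ℝ, ∃ ρ : ℝ, P ≤ ρ ∧ ε * ρ ^ 2 < ∫ y in ball 0 ρ, ‖w t₀ y‖ := by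
  intro t₀ ht₀
  by_contra h
  push Not at h
  have hmass : ∀ ε > 0, ∃ P : ℝ, ∀ ρ : ℝ, P ≤ ρ → ∫ y in ball 0 ρ, ‖w t₀ y‖ ≤ ε * ρ ^ 2 :=
    fun ε hε => h ε hε
  have hz := eq_zero_of_pastDss_of_sliceMass_littleO hw hD hc hpast ht₀ hmass
  obtain ⟨t, ht, x, -, hM⟩ := hsing 1 one_pos 0
  rw [hz t ht.2 x, norm_zero] at hM
  exact lt_irrefl _ hM

/-! ### Appended (lead g2): the matching upper bound — under a Type-I envelope the slice mass
is `O(ρ²)`, so for DSS members of the stratum only the constant in front of `ρ²` is at stake -/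

/-- **Slice mass under a space-time Type-I envelope is `O(ρ²)`.** If
`‖v(t,y)‖ ≤ C₀/(‖y‖ + √(−t))` on the past, then `∫_{B_ρ} ‖v(t)‖ ≤ C₀ · (3|B₁|/2) · ρ²` for every
`t < 0` and `ρ > 0` (`‖v(t,y)‖ ≤ C₀ ‖y‖⁻¹` off the origin and `∫_{B_ρ} ‖y‖⁻¹ dy = 3|B₁|ρ²/2`,
`NewtonPotentialHolder.integral_ball_norm_rpow_neg`). -/
theorem sliceMass_le_of_hasTypeIDecay {C₀ : ℝ}
    {v : ℝ → EuclideanSpace ℝ (Fin 3) → EuclideanSpace ℝ (Fin 3)} (hdec : HasTypeIDecay C₀ v)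
    {t : ℝ} (ht : t < 0) (hcont : Continuous (v t)) {ρ : ℝ} (hρ : 0 < ρ) :
    ∫ y in ball 0 ρ, ‖v t y‖ ≤
      C₀ * (3 * (volume : Measure (EuclideanSpace ℝ (Fin 3))).real (ball 0 1) / 2) * ρ ^ 2 := by
  have hst : 0 < Real.sqrt (-t) := Real.sqrt_pos.2 (neg_pos.2 ht)
  have hC₀ : 0 ≤ C₀ := by
    have h := hdec t ht 0
    rw [norm_zero, zero_add] at h
    by_contra hC
    have : C₀ / Real.sqrt (-t) < 0 := div_neg_of_neg_of_pos (not_le.1 hC) hst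
    linarith [norm_nonneg (v t 0)]
  -- pointwise, off the origin: `‖v t y‖ ≤ C₀ ‖y‖^{-1}`
  have hpt : ∀ y : EuclideanSpace ℝ (Fin 3), y ≠ 0 → ‖v t y‖ ≤ C₀ * ‖y‖ ^ (-(1 : ℝ)) := by
    intro y hy
    have hyn : 0 < ‖y‖ := norm_pos_iff.2 hy
    rw [Real.rpow_neg (norm_nonneg _), Real.rpow_one, ← div_eq_mul_inv]
    exact (hdec t ht y).trans
      (div_le_div_of_nonneg_left hC₀ hyn (le_add_of_nonneg_right (Real.sqrt_nonneg _)))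
  have hi1 : IntegrableOn (fun y : EuclideanSpace ℝ (Fin 3) => ‖y‖ ^ (-(1 : ℝ))) (ball 0 ρ) volume :=
    NewtonPotentialHolder.integrableOn_ball_norm_rpow_neg (by norm_num) ρ
  have hi2 : IntegrableOn (fun y : EuclideanSpace ℝ (Fin 3) => C₀ * ‖y‖ ^ (-(1 : ℝ))) (ball 0 ρ)
      volume := hi1.const_mul C₀
  have hiv : IntegrableOn (fun y => ‖v t y‖) (ball 0 ρ) volume :=
    (hcont.norm.continuousOn.integrableOn_compact (isCompact_closedBall 0 ρ)).mono_set
      ball_subset_closedBall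
  have h0 : ({0}ᶜ : Set (EuclideanSpace ℝ (Fin 3))) ∈ ae (volume : Measure (EuclideanSpace ℝ (Fin 3))) :=
    compl_mem_ae_iff.2 (measure_singleton 0)
  have hmono : ∫ y in ball 0 ρ, ‖v t y‖ ≤
      ∫ y in ball (0 : EuclideanSpace ℝ (Fin 3)) ρ, C₀ * ‖y‖ ^ (-(1 : ℝ)) := by
    refine integral_mono_ae hiv hi2 ?_
    filter_upwards [ae_restrict_of_ae (s := ball 0 ρ) h0] with y hy
    exact hpt y hy
  refine hmono.trans ?_
  rw [integral_const_mul, NewtonPotentialHolder.integral_ball_norm_rpow_neg (by norm_num) hρ]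
  have e : ρ ^ ((3 : ℝ) - 1) = ρ ^ 2 := by
    rw [show (3 : ℝ) - 1 = (2 : ℕ) by norm_num, Real.rpow_natCast]
  rw [e]
  have hV : 0 ≤ (volume : Measure (EuclideanSpace ℝ (Fin 3))).real (ball 0 1) := measureReal_nonneg
  apply le_of_eq
  ring

/-- **For past-DSS members of the stratum the slice mass is `O(ρ²)` uniformly in the slice**:
there is `A` with `∫_{B_ρ} ‖w(t)‖ ≤ A ρ²` for all `t < 0`, `ρ > 0` (envelope bridge
`exists_hasTypeIDecay_of_dss` + `sliceMass_le_of_hasTypeIDecay`). Together with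
`sliceMass_notLittleO_of_pastDss_singular`: on a singular member every slice has mass `≍ ρ²`
along radii `ρ → ∞`. -/
theorem exists_sliceMass_le_of_pastDss {C K c : ℝ}
    {w : ℝ → EuclideanSpace ℝ (Fin 3) → EuclideanSpace ℝ (Fin 3)} (hw : IsTypeIAncientMild C w)
    (hD : ∀ s : ℝ, s < 0 → ∫⁻ x, ‖fderiv ℝ (w s) x‖ₑ ^ 2 ≤ ENNReal.ofReal (K / Real.sqrt (-s)))
    (hc : 1 < c) (hpast : ∀ t : ℝ, t < 0 → ∀ x, c • w (c ^ 2 * t) (c • x) = w t x) :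
    ∃ A : ℝ, ∀ t < 0, ∀ ρ : ℝ, 0 < ρ → ∫ y in ball 0 ρ, ‖w t y‖ ≤ A * ρ ^ 2 := by
  obtain ⟨w', hdss', hp⟩ := exists_dss_extension_of_pastDSS (one_pos.trans hc) hpast
  have hw' : IsTypeIAncientMild C w' := CorkscrewProfile.Birth.isTypeIAncientMild_congr_neg hw hp
  have hD' : ∀ s : ℝ, s < 0 →
      ∫⁻ x, ‖fderiv ℝ (w' s) x‖ₑ ^ 2 ≤ ENNReal.ofReal (K / Real.sqrt (-s)) :=
    fun s hs => by rw [hp s hs]; exact hD s hs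
  obtain ⟨C₀, henv⟩ := exists_hasTypeIDecay_of_dss hw' hD' hc hdss'
  refine ⟨C₀ * (3 * (volume : Measure (EuclideanSpace ℝ (Fin 3))).real (ball 0 1) / 2),
    fun t ht ρ hρ => ?_⟩
  have h := sliceMass_le_of_hasTypeIDecay henv ht (hw'.continuous_slice ht) hρ
  rw [hp t ht] at h
  exact h

end Summit.NavierStokesRegularity.NavierStokesRegularity.Theorems.FiniteDissipationLiouville.Birth

end
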